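import Literature.NumberTheory.Sieve.FriedlanderIwaniecPrimesSectorReduction
import Literature.NumberTheory.Sieve.FriedlanderIwaniecPrimesDispersionCoprime
import HarnessLib

/-!
# Friedlander–Iwaniec, *The polynomial `X² + Y⁴` captures its primes*: Theorem 1 from the bound (5.25) for the coprime dispersion sum `𝒟*(M, N)`

Family `parity`, statement parity.S17 (`friedlanderIwaniecSum_isEquivalent`,
`setOf_prime_sq_add_pow_four_infinite`). Source: J. Friedlander, H. Iwaniec, Ann. of Math. (2) 148
(1998), 945–1040 [FriedlanderIwaniecAnnals1998], §5 (5.15)–(5.25) and §18 (the assembly of Theorem 1: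
"Recall that this had already, in the early sections of the paper been reduced to the proof of the
bound (4.23) for the bilinear form `B*(M, N)` … We re-trace the path we followed from (4.23) to
Proposition 10.2 and the conditions imposed on the parameters `A, A', B, τ`, and `P`").

This file is pure glue between two PROVED reductions in the tree:

* `friedlanderIwaniecSum_isEquivalent_of_sectorBound` (`…SectorReduction`, §§2–5 up to (5.16)):
  Theorem 1 follows from the sector bound (5.15) in the shape `Sector515At` (positive sieving
  parameter `P`);
* `bilinear515_of_dispersion` (`…Dispersion`, Cauchy (5.17)–(5.20)) and `dispersion_of_coprime`
  (`…DispersionCoprime`, (5.21)–(5.25) through Lemma 5.1): (5.15) in the shape `Bilinear515With`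
  follows from (5.20) (`DispersionBoundWith`), which follows from (5.25)
  (`CoprimeDispersionBoundWith`).

The two shapes of (5.15) are the same statement with the quantifiers bundled differently
(`sector515At_of_bilinear515With`). Consequently **Theorem 1 (parity.S17), (4.7)–(4.8) and the
infinitude of primes `a² + b⁴` follow from the single estimate (5.25)**
`𝒟*(M, N) ≪ ϑ² θ⁴ M^{1/2} N^{3/2} (log MN)⁸` for the coprime dispersion sum — the statement proved in
§§6–26 of the source (lattice points in the biquadratic ellipse §§6–9, the main term §10,
Proposition 10.2 ⇐ §§11–26). Everything here is PROVED; no definitions, no named facts.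

## Contents

* `FriedlanderIwaniecPrimes.sector515At_of_bilinear515With` — `Bilinear515With η A A₁ A' t B K`
  gives, eventually in `x`, `Sector515At x P N C A₁ θ τ ϑ K` for all positive `P` in (4.4), `N` in
  (4.6), `1 ≤ C ≤ N^{1-η}` (`θ = (log x)^{-A'}`, `τ = (log x)^t`, `ϑ = (log x)^{-A}`).
* `friedlanderIwaniecSum_isEquivalent_of_bilinear515`, `…_of_dispersionBound`,
  `…_of_coprimeDispersionBound` — parity.S17 from (5.15), from (5.20), from (5.25);
* `FriedlanderIwaniec1998_primeSum_asymp_of_coprimeDispersionBound` ((4.7)–(4.8)) and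
  `setOf_prime_sq_add_pow_four_infinite_of_coprimeDispersionBound`.

## References

* J. Friedlander, H. Iwaniec, Ann. of Math. (2) 148 (1998), 945–1040: (5.15)–(5.25), §18.
  [FriedlanderIwaniecAnnals1998]
-/

noncomputable section

open Filter Real

namespace Literature.NumberTheory.Sieve

namespace FriedlanderIwaniecPrimes

/-- The two bundlings of (5.15) agree: `Bilinear515With η A A₁ A' t B K` (regime as a structure)
yields `Sector515At x P N C A₁ (log x)^{-A'} (log x)^t (log x)^{-A} K` (curried, as consumed by
`FriedlanderIwaniec1998_bilinBound_of_sectorBound`) for all large `x` and all positive `P` in (4.4),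
`N` in (4.6) with exponent `B`, `1 ≤ C ≤ N^{1-η}`. [cite: FriedlanderIwaniecAnnals1998, (5.15)] -/
theorem sector515At_of_bilinear515With {η A A₁ A' t B K : ℝ} (h : Bilinear515With η A A₁ A' t B K) :
    ∀ᶠ x : ℝ in atTop,
      ∀ P : ℝ, 0 < P → Real.log (Real.log x) ^ 2 ≤ Real.log P →
        Real.log P ≤ Real.log x * (Real.log (Real.log x))⁻¹ ^ 2 →
      ∀ N : ℝ, x ^ (1 / 4 + η : ℝ) < N → N < x ^ (1 / 2 : ℝ) / Real.log x ^ B →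
      ∀ C : ℝ, 1 ≤ C → C ≤ N ^ (1 - η : ℝ) →
        Sector515At x P N C A₁ (Real.log x ^ (-A')) (Real.log x ^ t) (Real.log x ^ (-A)) K := by
  filter_upwards [h] with x hx P hP0 hP1 hP2 N hN1 hN2 C hC1 hC2
  intro M hM1 hM2 N' hN'1 hN'2 p hp1 hp2 hp3 hp4 hp5 z₀ φ hφ q hq1 hq2 hq3 hq4 hq5 hq6 α hα
  exact hx P N M C N' ⟨hP0, hP1, hP2, hN1, hN2, hM1, hM2, hC1, hC2, hN'1, hN'2⟩ p
    ⟨hp1, hp2, hp3, hp4, hp5⟩ z₀ φ q ⟨hφ, hq1, hq2, hq3, hq4, hq5, hq6⟩ α hα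

end FriedlanderIwaniecPrimes

open FriedlanderIwaniecPrimes

/-- **parity.S17 from (5.15)** in the bundled shape `Bilinear515With`: if for every `η, A, A₁ > 0`
there are `A' ≥ 2A + 2^20`, `t ≥ A + 124`, `B > 0`, `K > 0` with (5.15) throughout the regime, then
`∑∑_{a²+b⁴≤x} Λ(a²+b⁴) ∼ 4π⁻¹κx^{3/4}` (used at `A₁ = 2A + 8`, the `(4.19)`-exponent of
`…BilinearReduction`). [cite: FriedlanderIwaniecAnnals1998, Theorem 1 via (5.15)] -/
theorem friedlanderIwaniecSum_isEquivalent_of_bilinear515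
    (h : ∀ η : ℝ, 0 < η → ∀ A : ℝ, 0 < A → ∀ A₁ : ℝ, 0 < A₁ →
      ∃ A' t B K : ℝ, 2 * A + 2 ^ 20 ≤ A' ∧ A + 124 ≤ t ∧ 0 < B ∧ 0 < K ∧
        Bilinear515With η A A₁ A' t B K) :
    friedlanderIwaniecSum_isEquivalent := by
  refine friedlanderIwaniecSum_isEquivalent_of_sectorBound fun η hη A hA => ?_
  obtain ⟨A', t, B, K, hA', ht, hB, hK, h515⟩ := h η hη A hA (2 * A + 8) (by linarith)
  exact ⟨A', t, B, K, hA', ht, hB, hK, sector515At_of_bilinear515With h515⟩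

/-- **parity.S17 from (5.20)**: the dispersion bound `𝒟(M, N) ≪ ϑ² θ⁴ M^{1/2} N^{3/2} (log MN)⁸`
(`DispersionBoundWith`, with the quantifier discipline of `bilinear515_of_dispersion`) implies
Theorem 1. [cite: FriedlanderIwaniecAnnals1998, Theorem 1 via (5.20)] -/
theorem friedlanderIwaniecSum_isEquivalent_of_dispersionBound
    (h : ∀ η : ℝ, 0 < η → ∀ A : ℝ, 0 < A → ∀ A₁ : ℝ, 0 < A₁ →
      ∃ A' t B K : ℝ, 2 * A + 2 ^ 20 ≤ A' ∧ A + 124 ≤ t ∧ 0 < B ∧ 0 < K ∧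
        DispersionBoundWith η A A₁ A' t B K) :
    friedlanderIwaniecSum_isEquivalent :=
  friedlanderIwaniecSum_isEquivalent_of_bilinear515 (bilinear515_of_dispersion h)

/-- **parity.S17 from (5.25)**: the bound `𝒟*(M, N) ≪ ϑ² θ⁴ M^{1/2} N^{3/2} (log MN)⁸` for the
coprime dispersion sum (`CoprimeDispersionBoundWith`: for every `η, A, A₁ > 0` some
`A' ≥ 2A + 2^20`, `t ≥ A + 124`, `B > 0`, `K > 0` with (5.25) throughout the regime) implies
`∑∑_{a²+b⁴≤x} Λ(a²+b⁴) ∼ 4π⁻¹κx^{3/4}`. The hypothesis is what §§6–26 of the source prove.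
[cite: FriedlanderIwaniecAnnals1998, Theorem 1 via (5.25)] -/
theorem friedlanderIwaniecSum_isEquivalent_of_coprimeDispersionBound
    (h : ∀ η : ℝ, 0 < η → ∀ A : ℝ, 0 < A → ∀ A₁ : ℝ, 0 < A₁ →
      ∃ A' t B K : ℝ, 2 * A + 2 ^ 20 ≤ A' ∧ A + 124 ≤ t ∧ 0 < B ∧ 0 < K ∧
        CoprimeDispersionBoundWith η A A₁ A' t B K) :
    friedlanderIwaniecSum_isEquivalent :=
  friedlanderIwaniecSum_isEquivalent_of_dispersionBound (dispersion_of_coprime h)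

/-- **FI (4.7)–(4.8) from (5.25).** [cite: FriedlanderIwaniecAnnals1998, (4.7)-(4.8) via (5.25)] -/
theorem FriedlanderIwaniec1998_primeSum_asymp_of_coprimeDispersionBound
    (h : ∀ η : ℝ, 0 < η → ∀ A : ℝ, 0 < A → ∀ A₁ : ℝ, 0 < A₁ →
      ∃ A' t B K : ℝ, 2 * A + 2 ^ 20 ≤ A' ∧ A + 124 ≤ t ∧ 0 < B ∧ 0 < K ∧
        CoprimeDispersionBoundWith η A A₁ A' t B K) :
    FriedlanderIwaniec1998_primeSum_asymp := by
  refine FriedlanderIwaniec1998_primeSum_asymp_of_sectorBound fun η hη A hA => ?_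
  obtain ⟨A', t, B, K, hA', ht, hB, hK, h515⟩ :=
    bilinear515_of_dispersion (dispersion_of_coprime h) η hη A hA (2 * A + 8) (by linarith)
  exact ⟨A', t, B, K, hA', ht, hB, hK, sector515At_of_bilinear515With h515⟩

/-- **Infinitely many primes `p = a² + b⁴` from (5.25).**
[cite: FriedlanderIwaniecAnnals1998, Theorem 1 via (5.25)] -/
theorem setOf_prime_sq_add_pow_four_infinite_of_coprimeDispersionBound
    (h : ∀ η : ℝ, 0 < η → ∀ A : ℝ, 0 < A → ∀ A₁ : ℝ, 0 < A₁ →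
      ∃ A' t B K : ℝ, 2 * A + 2 ^ 20 ≤ A' ∧ A + 124 ≤ t ∧ 0 < B ∧ 0 < K ∧
        CoprimeDispersionBoundWith η A A₁ A' t B K) :
    setOf_prime_sq_add_pow_four_infinite := by
  refine setOf_prime_sq_add_pow_four_infinite_of_sectorBound fun η hη A hA => ?_
  obtain ⟨A', t, B, K, hA', ht, hB, hK, h515⟩ :=
    bilinear515_of_dispersion (dispersion_of_coprime h) η hη A hA (2 * A + 8) (by linarith)
  exact ⟨A', t, B, K, hA', ht, hB, hK, sector515At_of_bilinear515With h515⟩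

end Literature.NumberTheory.Sieve
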